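import Summits.Ventures.PercRepro.RankLevelSetRuleQSliceFirstUntruncLarge
import Summits.Ventures.PercRepro.RankLevelSetRuleQSliceSecondUntruncTwo

/-!
# PercRepro — THE SECOND UNTRUNCATED SLICE `u = k` ON EVERY CELL OF EVERY FAMILY (night-1, gen 22; dossier §33)

The slice `u = k` is paid on its bottom regime `k ≤ q ≤ k² + k` (`second_untrunc_slice_complete`, gen 21) and, for `k ≤ 10`, on
every cell (`rhat_slice_iff_all_ten`). The large-q half `q ≥ k² + k + 1` is ONE MORE STEP of the climb of
RankLevelSetRuleQSliceBorderClimb, now from the first untruncated slice `u = k − 1` (every cell, `first_untrunc_slice_every`):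
both slices are untruncated, so the tree's `phiK_le_rhat_of_sliceStep` applies verbatim with the monotone step
`C(2k−1, k−1)·S_k(q, m) ≤ S_1(q, m)` at `q = m + k`:
* `rhat_le_sliceL_of_untrunc` — `R̂(q, k, m') ≤ L(q, k, m')` on the untruncated slices `k − 1 ≤ q − m'` (in fact equal);
* `choose_odd_mul_two` — `2·C(2n+1, n) = C(2n+2, n+1)`, so `C(2K+3, K+1)` grows like a central binomial;
* `tK2` — the `k`-recursion `18·C(2K+3, K+1) ≤ C(K² + 4K + 5 + d + 1, d)` (`d = ⌊(K+1)/2⌋`, `K ≥ 9`) by a two-step induction;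
* `step_second` — the monotone step from the moment bounds on `q ≥ k² + k + 1` (`(K+1)·(2J_2) ≤ 17/18`, the rest `≤ 1/18`);
* **`second_untrunc_large`** — `Φ(q+k, q) ≤ R̂(q, k, q − k)` for `k ≥ 11`, `q ≥ k² + k + 1`;
* **`second_untrunc_slice_every`** — THE SECOND UNTRUNCATED SLICE IS PAID ON EVERY CELL `q ≥ k` OF EVERY FAMILY `k ≥ 5`;
  **`ruleQRecv_ge_phiK_second_untrunc_every`** — the matroid level.
Axioms: standard.
-/

namespace PercRepro

open Finset

/-- `R̂(q, k, m') ≤ L(q, k, m')` on the untruncated slices `k − 1 ≤ q − m'` (every swap count is the full Vandermonde count). -/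
lemma rhat_le_sliceL_of_untrunc (q k m' : ℕ) (h : k - 1 ≤ q - m') :
    rhat q k m' ≤ ∑ j ∈ Finset.Ioo 0 k, ((q + k - m').choose j : ℚ) * sliceS q m' j := by
  unfold rhat
  apply le_of_eq
  refine Finset.sum_congr rfl (fun j hj => ?_)
  rw [Finset.mem_Ioo] at hj
  unfold sliceS
  rw [Finset.mul_sum]
  refine Finset.sum_congr rfl (fun a _ => ?_)
  rw [mhat_eq_choose_of_le q m' a j (by omega)]
  push_cast
  ring

/-- `2·C(2n+1, n) = C(2n+2, n+1)` (Pascal and the symmetry of the odd row). -/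
lemma choose_odd_mul_two (n : ℕ) : 2 * (2 * n + 1).choose n = (2 * n + 2).choose (n + 1) := by
  have h1 := Nat.choose_succ_succ' (2 * n + 1) n
  have h2 : (2 * n + 1).choose (n + 1) = (2 * n + 1).choose n := by
    rw [show 2 * n + 1 = n + (n + 1) by ring, Nat.choose_symm_add]
  rw [show 2 * n + 2 = 2 * n + 1 + 1 by ring, h1, h2]
  ring

/-- `C(2n+3, n+1) ≤ 4·C(2n+1, n)`. -/
lemma choose_odd_succ_le (n : ℕ) : (2 * (n + 1) + 1).choose (n + 1) ≤ 4 * (2 * n + 1).choose n := by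
  have h1 := choose_odd_mul_two n
  have h2 := choose_odd_mul_two (n + 1)
  have h3 := choose_two_mul_succ_le (n + 1)
  rw [show 2 * (n + 1) = 2 * n + 2 by ring] at h3
  rw [show 2 * (n + 1) + 2 = 2 * (n + 1 + 1) by ring] at h2
  omega

/-- **The `k`-recursion of the second step** `tK2`: for `K ≥ 9` and `d = ⌊(K+1)/2⌋`,
`18·C(2K+3, K+1) ≤ C(K² + 4K + 5 + d + 1, d)` (two-step induction: the left side grows by `< 16` per `K ↦ K + 2`, the right
side by `≥ 2K + 2`). -/
lemma tK2 (K : ℕ) (hK : 9 ≤ K) :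
    18 * (2 * K + 3).choose (K + 1) ≤ (K * K + 4 * K + 5 + (K + 1) / 2 + 1).choose ((K + 1) / 2) := by
  obtain ⟨n, rfl⟩ : ∃ n, K = 9 + n := ⟨K - 9, by omega⟩
  clear hK
  induction n using Nat.twoStepInduction with
  | zero =>
    rw [show Nat.choose (2 * (9 + 0) + 3) (9 + 0 + 1) = 352716 by decide,
      show (9 + 0 + 1) / 2 = 5 from rfl, show (9 + 0) * (9 + 0) + 4 * (9 + 0) + 5 + 5 + 1 = 128 from rfl,
      show Nat.choose 128 5 = 264566400 by
        rw [Nat.choose_eq_descFactorial_div_factorial]; norm_num [Nat.descFactorial, Nat.factorial]]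
    norm_num
  | one =>
    rw [show Nat.choose (2 * (9 + 1) + 3) (9 + 1 + 1) = 1352078 by decide,
      show (9 + 1 + 1) / 2 = 5 from rfl, show (9 + 1) * (9 + 1) + 4 * (9 + 1) + 5 + 5 + 1 = 151 from rfl,
      show Nat.choose 151 5 = 611860305 by
        rw [Nat.choose_eq_descFactorial_div_factorial]; norm_num [Nat.descFactorial, Nat.factorial]]
    norm_num
  | more n ih _ =>
    set K := 9 + n with hKdef
    rw [show 9 + (n + 2) = K + 2 by omega]
    set d := (K + 1) / 2 with hd
    have hd5 : 5 ≤ d := by omega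
    have hd2 : (K + 2 + 1) / 2 = d + 1 := by omega
    rw [hd2]
    have hA : (2 * (K + 2) + 3).choose (K + 2 + 1) ≤ 16 * (2 * K + 3).choose (K + 1) := by
      have e1 := choose_odd_succ_le (K + 1)
      have e2 := choose_odd_succ_le (K + 2)
      rw [show 2 * (K + 1 + 1) + 1 = 2 * K + 5 by ring, show K + 1 + 1 = K + 2 by ring,
        show 2 * (K + 1) + 1 = 2 * K + 3 by ring] at e1
      rw [show 2 * (K + 2 + 1) + 1 = 2 * (K + 2) + 3 by ring, show 2 * (K + 2) + 1 = 2 * K + 5 by ring] at e2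
      omega
    have hB : (2 * K + 2) * (K * K + 4 * K + 5 + d + 1).choose d
        ≤ ((K + 2) * (K + 2) + 4 * (K + 2) + 5 + (d + 1) + 1).choose (d + 1) := by
      have e1 := Nat.add_one_mul_choose_eq (K * K + 4 * K + 5 + d + 1) d
      -- e1 : (N + 1) * C(N, d) = C(N + 1, d + 1) * (d + 1), N = K² + 4K + 5 + d + 1
      have e2 : (K * K + 4 * K + 5 + d + 1 + 1).choose (d + 1)
          ≤ ((K + 2) * (K + 2) + 4 * (K + 2) + 5 + (d + 1) + 1).choose (d + 1) :=
        Nat.choose_le_choose (d + 1) (by nlinarith)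
      have h2d : 2 * d ≤ K + 1 := by omega
      have e3 : (2 * K + 2) * (d + 1) ≤ K * K + 4 * K + 5 + d + 1 + 1 := by nlinarith [h2d]
      calc (2 * K + 2) * (K * K + 4 * K + 5 + d + 1).choose d
          ≤ (K * K + 4 * K + 5 + d + 1 + 1) * (K * K + 4 * K + 5 + d + 1).choose d / (d + 1) := by
            rw [Nat.le_div_iff_mul_le (by omega)]
            nlinarith
        _ = (K * K + 4 * K + 5 + d + 1 + 1).choose (d + 1) := by
            rw [e1, Nat.mul_div_cancel _ (by omega)]
        _ ≤ _ := e2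
    calc 18 * (2 * (K + 2) + 3).choose (K + 2 + 1)
        ≤ 18 * (16 * (2 * K + 3).choose (K + 1)) := Nat.mul_le_mul_left _ hA
      _ = 16 * (18 * (2 * K + 3).choose (K + 1)) := by ring
      _ ≤ 16 * (K * K + 4 * K + 5 + d + 1).choose d := Nat.mul_le_mul_left _ ih
      _ ≤ (2 * K + 2) * (K * K + 4 * K + 5 + d + 1).choose d := Nat.mul_le_mul_right _ (by omega)
      _ ≤ _ := hB

/-- **The monotone step for the second untruncated slice** (`q = m + K + 2`, `k = K + 2 ≥ 11`, `m ≥ k² + 1`):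
`C(2K+3, K+1)·S_{K+2}(q, m) ≤ S_1(q, m)`. -/
lemma step_second (K m : ℕ) (hK : 9 ≤ K) (hm : K * K + 4 * K + 5 ≤ m) :
    ((2 * K + 3).choose (K + 1) : ℚ) * sliceS (m + 1 + (K + 1)) m (K + 2) ≤ sliceS (m + 1 + (K + 1)) m 1 := by
  set d := (K + 1) / 2 with hd
  have hd5 : 5 ≤ d := by omega
  have hlow := sliceS_one_ge m (K + 1)
  have hup := sliceS_le_odd m (K + 2) d (show m + 1 ≤ m + 1 + (K + 1) by omega) (by omega)
  have hρ := diag_two_sq_le m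
  have hρ0 : (0 : ℚ) ≤ 2 * sliceS (m + 1) m 2 := by
    have := sliceS_nonneg (m + 1) m 2; positivity
  have hmK : ((K : ℚ) + 1) ^ 2 ≤ m := by
    have : (K + 1) ^ 2 ≤ m := by nlinarith
    exact_mod_cast this
  have h1 : ((K : ℚ) + 1) * (2 * sliceS (m + 1) m 2) ≤ 17 / 18 := by
    have hsq : (((K : ℚ) + 1) * (2 * sliceS (m + 1) m 2)) ^ 2 ≤ (17 / 18) ^ 2 := by
      calc (((K : ℚ) + 1) * (2 * sliceS (m + 1) m 2)) ^ 2
          = ((K : ℚ) + 1) ^ 2 * (2 * sliceS (m + 1) m 2) ^ 2 := by ring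
        _ ≤ ((K : ℚ) + 1) ^ 2 * (8 / (9 * ((m : ℚ) + 2))) := by gcongr
        _ ≤ (17 / 18) ^ 2 := by
            rw [show ((K : ℚ) + 1) ^ 2 * (8 / (9 * ((m : ℚ) + 2))) = 8 * ((K : ℚ) + 1) ^ 2 / (9 * ((m : ℚ) + 2)) by
              field_simp, div_le_iff₀ (by positivity)]
            nlinarith
    nlinarith [hsq, hρ0]
  have hT := tK2 K hK
  rw [← hd] at hT
  have hmono : ((K * K + 4 * K + 5 + d + 1).choose d : ℚ) ≤ ((m + d + 1).choose d : ℚ) := by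
    exact_mod_cast Nat.choose_le_choose d (by omega)
  have hTq : (18 : ℚ) * ((2 * K + 3).choose (K + 1) : ℚ) ≤ ((m + d + 1).choose d : ℚ) := by
    have : (18 : ℚ) * ((2 * K + 3).choose (K + 1) : ℚ) ≤ ((K * K + 4 * K + 5 + d + 1).choose d : ℚ) := by
      exact_mod_cast hT
    exact this.trans hmono
  have hB : (0 : ℚ) < ((m + d + 1).choose d : ℚ) := Nat.cast_pos.mpr (Nat.choose_pos (by omega))
  have hx : (0 : ℚ) < ((m + 1 + (K + 1) : ℕ) : ℚ) / ((m : ℚ) + 1) := by positivity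
  have h2 : ((2 * K + 3).choose (K + 1) : ℚ) / ((m + d + 1).choose d : ℚ) ≤ 1 / 18 := by
    rw [div_le_iff₀ hB]; linarith
  calc ((2 * K + 3).choose (K + 1) : ℚ) * sliceS (m + 1 + (K + 1)) m (K + 2)
      ≤ ((2 * K + 3).choose (K + 1) : ℚ)
          * (((m + 1 + (K + 1) : ℕ) : ℚ) / ((m : ℚ) + 1) * (1 / (2 * ((m + d + 1).choose d : ℚ)))) :=
        mul_le_mul_of_nonneg_left hup (by positivity)
    _ = ((2 * K + 3).choose (K + 1) : ℚ) / ((m + d + 1).choose d : ℚ)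
          * (((m + 1 + (K + 1) : ℕ) : ℚ) / (2 * ((m : ℚ) + 1))) := by
        field_simp
    _ ≤ 1 / 18 * (((m + 1 + (K + 1) : ℕ) : ℚ) / (2 * ((m : ℚ) + 1))) :=
        mul_le_mul_of_nonneg_right h2 (by positivity)
    _ ≤ ((m + 1 + (K + 1) : ℕ) : ℚ) / (2 * ((m : ℚ) + 1)) * (1 - ((K + 1 : ℕ) : ℚ) * (2 * sliceS (m + 1) m 2)) := by
        have hy0 : (0 : ℚ) ≤ ((m + 1 + (K + 1) : ℕ) : ℚ) / (2 * ((m : ℚ) + 1)) := by positivity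
        have h1' : ((K + 1 : ℕ) : ℚ) * (2 * sliceS (m + 1) m 2) ≤ 17 / 18 := by push_cast; exact h1
        have := mul_le_mul_of_nonneg_left h1' hy0
        nlinarith [this, hy0]
    _ ≤ sliceS (m + 1 + (K + 1)) m 1 := hlow

/-- **THE LARGE-q HALF OF THE SECOND UNTRUNCATED SLICE**: for `k = K + 2 ≥ 11` and `q = m + K + 2 ≥ k² + k + 1`,
`Φ(q+k, q) ≤ R̂(q, k, m)` (the slice `u = k`): one slice step up from `first_untrunc_slice_every`. -/
theorem second_untrunc_large (K m : ℕ) (hK : 9 ≤ K) (hm : K * K + 4 * K + 5 ≤ m) :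
    phiK (m + 1 + (K + 1) + (K + 2)) (m + 1 + (K + 1)) ≤ rhat (m + 1 + (K + 1)) (K + 2) m := by
  have h1 : phiK (m + 1 + (K + 1) + (K + 2)) (m + 1 + (K + 1)) ≤ rhat (m + 1 + (K + 1)) (K + 2) (m + 1) := by
    have := first_untrunc_slice_every (K + 2) (m + 1 + (K + 1)) (by omega) (by omega)
    rwa [show m + 1 + (K + 1) - (K + 2 - 1) = m + 1 by omega] at this
  have h2 := rhat_le_sliceL_of_untrunc (m + 1 + (K + 1)) (K + 2) (m + 1) (by omega)
  have h1' : phiK (m + 1 + (K + 1) + (K + 2)) (m + 1 + (K + 1))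
      ≤ ∑ j ∈ Finset.Ioo 0 (K + 2), ((m + 1 + (K + 1) + (K + 2) - (m + 1)).choose j : ℚ)
          * ∑ a ∈ range (m + 1 + 1), ((m + 1).choose a : ℚ) / ((m + 1 + (K + 1) + j + a).choose (a + j) : ℚ) :=
    h1.trans h2
  have hstep := step_second K m hK hm
  have hstep' : ((K + 1 + (K + 2)).choose (K + 2 - 1) : ℚ)
      * ∑ a ∈ range (m + 1), (m.choose a : ℚ) / ((m + 1 + (K + 1) + (K + 2) + a).choose (a + (K + 2)) : ℚ)
      ≤ ∑ a ∈ range (m + 1), (m.choose a : ℚ) / ((m + 1 + (K + 1) + 1 + a).choose (a + 1) : ℚ) := by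
    rw [show K + 1 + (K + 2) = 2 * K + 3 by ring, show K + 2 - 1 = K + 1 by omega]
    exact hstep
  exact phiK_le_rhat_of_sliceStep (K + 1) (K + 2) m (by omega) h1' hstep'

/-- **THE SECOND UNTRUNCATED SLICE `u = k` IS PAID ON EVERY CELL OF EVERY FAMILY `k ≥ 5`**:
`Φ(q+k, q) ≤ R̂(q, k, q − k)` for every `q ≥ k` (`k ≤ 10`: `rhat_slice_iff_all_ten`; `k ≥ 11`, `q ≤ k² + k`:
`second_untrunc_slice_complete`; `k ≥ 11`, `q ≥ k² + k + 1`: `second_untrunc_large`). -/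
theorem second_untrunc_slice_every (k q : ℕ) (hk : 5 ≤ k) (hq : k ≤ q) :
    phiK (q + k) q ≤ rhat q k (q - k) := by
  rcases Nat.lt_or_ge k 11 with h10 | h11
  · exact ((rhat_slice_iff_all_ten k k hk (by omega)).mpr (Or.inr (by omega))) q hq
  · rcases Nat.lt_or_ge q (k * k + k + 1) with hsmall | hlarge
    · exact second_untrunc_slice_complete k q hk hq (by omega)
    · obtain ⟨K, rfl⟩ : ∃ K, k = K + 2 := ⟨k - 2, by omega⟩
      obtain ⟨m, rfl⟩ : ∃ m, q = m + 1 + (K + 1) := ⟨q - 2 - K, by omega⟩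
      rw [show m + 1 + (K + 1) - (K + 2) = m by omega]
      exact second_untrunc_large K m (by omega) (by nlinarith)

/-- **The slice map entry `u = k`, every family `k ≥ 5`**: the slice is paid on every cell. -/
theorem rhat_second_untrunc_slice (k : ℕ) (hk : 5 ≤ k) :
    ∀ q, k ≤ q → phiK (q + k) q ≤ rhat q k (q - k) :=
  fun q hq => second_untrunc_slice_every k q hk hq

/-- **THE MATROID LEVEL**: at the tight layer `#E = (q+k) + q` of every finite matroid, every member `Z` of the cell
`(q+k, q)` with `#(flatPart M Z) = q − k` receives at least `Φ(q+k, q)` under Rule Q's equal split, for every `k ≥ 5` and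
every `q ≥ k`. -/
theorem ruleQRecv_ge_phiK_second_untrunc_every {β : Type} (M : Matroid β) [M.Finite] {q k : ℕ} (hk : 5 ≤ k)
    (hq : k ≤ q) (hE : M.E.ncard = (q + k) + q) {Z : Set β} (hZ : Z ∈ cellMembers M (q + k) q)
    (hP : (flatPart M Z).ncard = q - k) :
    phiK (q + k) q ≤ ruleQRecv M (q + k) q Z := by
  have h1 := second_untrunc_slice_every k q hk hq
  have h2 := rhat_le_ruleQRecv M hE hZ
  rw [hP] at h2
  exact h1.trans h2

end PercRepro
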